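import Summits.HodgeConjecture.HodgeConjecture.Theorems.F0P3cDyRamNormClassPlusConj            -- ★ p854758 (this seat): `table_vanishing_of_shellLabel` (the stub modulo `hShell`); brings ★ №3 Pieces, ★ №6, ★ `F0P3cDyRamPiecesShellLemmas`, ★ `WildQuadraticDatumRefSkewScalar`
import Summits.HodgeConjecture.HodgeConjecture.Theorems.F0P3cDyRamUnitaryTransvectionShape     -- ★ p854772 (this seat): `exists_eq_smul_vecMulVec_pairing` (X = c • v ⊗ (σv)Φ)
import Summits.HodgeConjecture.HodgeConjecture.Theorems.F0P3cDyRamUnipotentLabelInjOn            -- ★ (LH4-p02 (g12)): `B₀_xPlus_mulVec`; brings ★ `F0P3cDyRamWildPlaceDatum` (`exists_isRamifiedQuadraticDatum_of_placesOver`), ★ `UnitaryLatticeTreeDual` (`pairing_antidiagonal`)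
import Summits.HodgeConjecture.HodgeConjecture.Theorems.F0P3cDyRamDOfPlaceOfDatum               -- ★ (LH4-p02 (g12)): `dOfPlace_eq_of_isRamifiedQuadraticDatum`
import HarnessLib

/-!
# Crux `H413`, line LH4 «(D-RAM) FOUR-FRAME», tier 2 under `U4_Rows` §2 (iv-a)·T2: THE SHELL-LABEL LEMMA — a class-`+` unitary transvection on the near-transvection
# shell has the value-set label `+` (`NearTransvShell ∧ X² = 0 ∧ NormClassPlus ⇒ LabelPlus`), discharging the hypothesis `hShell` of ★ `table_vanishing_of_shellLabel`

Cell `hodgecm-mathlib` (D-0151), FLOOR 0, crux item H413 = `stmt-HodgeConjecture-24833`, route of record `HCCMUnconditional`; squad F0∕P3c∕LH4, Track A; dealer LH4-plan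
(g10) WORD #17∕#18 (U4 §2 `stub_U4_table_vanishing`); tier-2 hand LH4-p03 (g11).  THEOREMS ONLY (no `def`, no instance, no notation, no `sorry`, default heartbeats);
lane `--supports stmt-HodgeConjecture-24833 --as helper`.

THE MATHEMATICS.  Let `σ` be an involutive isometry of the valued field `K`, `Φ₃ = antidiag(1,1,1)`, `⟨x, y⟩ = Σ σ(x_i) y_{rev i}` (★ `pairing` = ★ `B₀`).  By ★
`exists_eq_smul_vecMulVec_pairing` a unitary transvection has `X = c • v ⊗ r`, `r = (σv)Φ₃ = (σ v_{rev j})_j`, so `X y = c·s(y)·v` with `s(y) = r ⬝ y` and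
**`⟨y, X y⟩ = c·s(y)·σ(s(y))`** — `c` times a NORM (§1).  On integral vectors `s` takes exactly the values `r_{j₀}·𝒪`, `r_{j₀}` a coefficient of largest valuation, so
the integral value set of `X` is `c·N(r_{j₀})·N(𝒪)`, while that of ★ `xPlus = t₊·E₀₂` is `t₊·N(𝒪)` (★ `B₀_xPlus_mulVec`).  The entries of `X` are `c·v_a·r_b` with
`|v_a| = |r_{rev a}| ≤ |r_{j₀}|`, so the largest entry has valuation `|c|·|r_{j₀}|² = |c·N(r_{j₀})|`; the SHELL `X ∈ ϖ^{ℓ₀}M₃(𝒪) ∖ ϖ^{ℓ₀+1}M₃(𝒪)` says this is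
`exp(−ℓ₀)`, `ℓ₀ = d % 2`, which is ALSO `|t₊|` (★ `v_refSkewScalar`).  `NormClassPlus` says `c·N(s(y)) = t₊·N(y′₂)·N(z) ≠ 0` for some vectors, i.e. `c ∈ t₊·N(K^×)`,
hence `c·N(r_{j₀}) = t₊·N(u)`; comparing valuations `|u|² = 1`, so `u` is a UNIT and `c·N(r_{j₀})·N(𝒪) = t₊·N(u𝒪) = t₊·N(𝒪)`: the two integral value sets
coincide EXACTLY, a fortiori modulo `ϖ^{m}` — `LabelPlus σ ϖ d m X` (§2–§3).  §4 instantiates at a ramified `σ`-stable CM place (`σ_w` involutive isometric,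
`wMatrix g ∈ U(σ_w, Φ₃)` ★ `coe_mem_unitaryGroupOfForm_over`, `dOfPlace = d` of the datum ★ `dOfPlace_eq_of_isRamifiedQuadraticDatum`) and discharges `hShell`.

* §1 `vecMul_antidiagonal_three`, `smul_vecMulVec_mulVec`, `pairing_shape_mulVec` (`⟨y, Xy⟩ = c·s·σs`), `pairing_xPlus_mulVec`.
* §2 `valueSetMod_eq_of_forall_exists` (equal integral pairing values ⇒ equal value sets), `v_inv_varpi_pow_mul_le_one_iff`.
* §3 **`labelPlus_of_shape`** — the shell-label lemma over any valued field with an involutive isometry.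
* §4 **`labelPlus_of_normClassPlus_of_nearTransvShell`** (CM place), **`shellLabel`** = the hypothesis `hShell` of ★ `table_vanishing_of_shellLabel`, discharged.

HONEST LABEL.  Count-neutral helper (no stub paid here; the payer of `stub_U4_table_vanishing` is the next file).  (D-RAM) verdict of record PRINT [LanglandsShelstad1989
Thm. p. 484 ∕ Rogawski1990 Prop. 4.9.1 (a)] ∕ XL; `HC_CM` is proved only modulo the 7 printed citations (2 remaining: hLiu418 = `stmt-HodgeConjecture-24832`, h413 =
`stmt-HodgeConjecture-24833`) until rung 0 closes.
-/

noncomputable section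

namespace Summit.HodgeConjecture.HodgeConjecture.Cruxes.H413.F0P3cDyRamShellLabelPlus

open NumberField IsDedekindDomain
open Literature.NumberTheory.Automorphic Literature.NumberTheory.Automorphic.UnitaryGroup
open Literature.NumberTheory.Automorphic.UnitaryLatticeTree Literature.NumberTheory.Automorphic.HermitianLattice
open Literature.NumberTheory.Automorphic.UnitaryThreeFourFrame
open Literature.NumberTheory.Rogawski1990 Literature.NumberTheory.GaloisRepresentations
open Literature.NumberTheory.LocalFields.WildQuadraticDatum
open Summit.HodgeConjecture.HodgeConjecture.Cruxes.H413.F0P3cDyRamFourFramePieces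
open Summit.HodgeConjecture.HodgeConjecture.Cruxes.H413.F0P3cDyRamFourFrameUnipotentLabelDefs
open Summit.HodgeConjecture.HodgeConjecture.Cruxes.H413.F0P3cDyRamPiecesShellLemmas
open Summit.HodgeConjecture.HodgeConjecture.Cruxes.H413.F0P3cDyRamUnitaryTransvectionShape
open Summit.HodgeConjecture.HodgeConjecture.Cruxes.H413.F0P3cDyRamUnipotentLabelInjOn (B₀_xPlus_mulVec)
open Summit.HodgeConjecture.HodgeConjecture.Cruxes.H413.F0P3cDyRamWildPlaceDatum (exists_isRamifiedQuadraticDatum_of_placesOver)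
open Summit.HodgeConjecture.HodgeConjecture.Cruxes.H413.F0P3cDyRamDOfPlaceOfDatum (dOfPlace_eq_of_isRamifiedQuadraticDatum)
open Summit.HodgeConjecture.HodgeConjecture.Cruxes.H413 (F0P3cDyRamProfilePiecesProps.coe_mem_unitaryGroupOfForm_over)
open scoped Matrix MatrixGroups ValuativeRel
open WithZero

section Field

variable {K : Type*} [Field K] [Valued K ℤᵐ⁰]

/-! ## §1  The pairing of the hermitian rank-one shape `c • v ⊗ (σv)Φ₃` -/

omit [Valued K ℤᵐ⁰] in
/-- Row vectors against `Φ₃ = antidiag(1,1,1)`: `(u·Φ₃)_j = u_{rev j}`. -/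
theorem vecMul_antidiagonal_three (u : Fin 3 → K) :
    Matrix.vecMul u ((StdForm.antidiagonal 3).over K) = fun j => u (Fin.rev j) := by
  funext j
  change ∑ i, u i * (StdForm.antidiagonal 3).over K i j = u (Fin.rev j)
  rw [Finset.sum_eq_single (Fin.rev j)]
  · rw [antidiagonal_over_apply, if_pos (Fin.rev_rev j).symm, mul_one]
  · intro i _ hi
    rw [antidiagonal_over_apply, if_neg (fun h => hi (by rw [h, Fin.rev_rev])), mul_zero]
  · exact fun h => absurd (Finset.mem_univ _) h

omit [Valued K ℤᵐ⁰] in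
/-- `(c • v ⊗ r)·y = (c·(r ⬝ y)) • v`. -/
theorem smul_vecMulVec_mulVec (c : K) (v r y : Fin 3 → K) :
    (c • Matrix.vecMulVec v r).mulVec y = (c * (r ⬝ᵥ y)) • v := by
  rw [Matrix.smul_mulVec, Matrix.vecMulVec_mulVec, op_smul_eq_smul, smul_smul]

omit [Valued K ℤᵐ⁰] in
/-- **`⟨y, X y⟩ = c·s·σ(s)`** for the hermitian rank-one shape `X = c • v ⊗ (σv)Φ₃` and `s = (σv)Φ₃ ⬝ y = Σ_j σ(v_{rev j})·y_j`, `σ` an involution: the pairing value of a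
unitary transvection is `c` times a NORM. -/
theorem pairing_shape_mulVec {σ : K →+* K} (hσ : ∀ x, σ (σ x) = x) (c : K) (v y : Fin 3 → K) :
    pairing σ ((StdForm.antidiagonal 3).over K) y
        ((c • Matrix.vecMulVec v (Matrix.vecMul (σ ∘ v) ((StdForm.antidiagonal 3).over K))).mulVec y) =
      c * ((Matrix.vecMul (σ ∘ v) ((StdForm.antidiagonal 3).over K) ⬝ᵥ y) *
        σ (Matrix.vecMul (σ ∘ v) ((StdForm.antidiagonal 3).over K) ⬝ᵥ y)) := by
  rw [smul_vecMulVec_mulVec, map_smul, smul_eq_mul, pairing_antidiagonal, B₀_apply, vecMul_antidiagonal_three]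
  have r0 : Fin.rev (0 : Fin 3) = 2 := by decide
  have r1 : Fin.rev (1 : Fin 3) = 1 := by decide
  have r2 : Fin.rev (2 : Fin 3) = 0 := by decide
  simp only [dotProduct, Function.comp_apply, map_add, map_mul, hσ, Fin.sum_univ_three, r0, r1, r2]
  ring

omit [Valued K ℤᵐ⁰] in
/-- `⟨y, X₊ y⟩ = t₊·(y₂·σ y₂)` for the reference nilpotent ★ `xPlus σ ϖ d = t₊·E₀₂` (★ `B₀_xPlus_mulVec`, read through ★ `pairing_antidiagonal`). -/
theorem pairing_xPlus_mulVec (σ : K →+* K) (ϖ : K) (d : ℕ) (y : Fin 3 → K) :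
    pairing σ ((StdForm.antidiagonal 3).over K) y ((xPlus σ ϖ d).mulVec y) =
      (ϖ - σ ϖ) * ((ϖ * σ ϖ) ^ ((d - d % 2) / 2))⁻¹ * (y 2 * σ (y 2)) := by
  rw [pairing_antidiagonal, B₀_xPlus_mulVec, mul_comm (σ (y 2))]

/-! ## §2  Value sets from integral pairing values -/

/-- Two matrices whose pairings take the same values on integral vectors have the same value set modulo every `ϖ^m` (★ `valueSetMod` reads nothing else). -/
theorem valueSetMod_eq_of_forall_exists (σ : K →+* K) (ϖ : K) (m : ℕ) {X X' : Matrix (Fin 3) (Fin 3) K}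
    (h : ∀ y : Fin 3 → K, (∀ a, Valued.v (y a) ≤ 1) → ∃ y' : Fin 3 → K, (∀ a, Valued.v (y' a) ≤ 1) ∧
      pairing σ ((StdForm.antidiagonal 3).over K) y' (X'.mulVec y') = pairing σ ((StdForm.antidiagonal 3).over K) y (X.mulVec y))
    (h' : ∀ y' : Fin 3 → K, (∀ a, Valued.v (y' a) ≤ 1) → ∃ y : Fin 3 → K, (∀ a, Valued.v (y a) ≤ 1) ∧
      pairing σ ((StdForm.antidiagonal 3).over K) y (X.mulVec y) = pairing σ ((StdForm.antidiagonal 3).over K) y' (X'.mulVec y')) :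
    valueSetMod σ ϖ m X = valueSetMod σ ϖ m X' := by
  ext z
  constructor
  · rintro ⟨y, hy, hz⟩
    obtain ⟨y', hy', he⟩ := h y hy
    exact ⟨y', hy', by rw [he]; exact hz⟩
  · rintro ⟨y', hy', hz⟩
    obtain ⟨y, hy, he⟩ := h' y' hy'
    exact ⟨y, hy, by rw [he]; exact hz⟩

/-- `|(ϖ^n)⁻¹·x| ≤ 1 ↔ |x| ≤ exp(−n)` for a uniformiser `ϖ` (`|ϖ| = exp(−1)`). -/
theorem v_inv_varpi_pow_mul_le_one_iff {ϖ : K} (hϖ : Valued.v ϖ = exp (-1 : ℤ)) (n : ℕ) (x : K) :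
    Valued.v ((ϖ ^ n)⁻¹ * x) ≤ 1 ↔ Valued.v x ≤ exp (-(n : ℤ)) := by
  rw [map_mul, map_inv₀, map_pow, v_varpi_pow hϖ]
  by_cases hx : x = 0
  · simp [hx]
  · have hvx : Valued.v x ≠ 0 := (Valuation.ne_zero_iff _).2 hx
    rw [← exp_log hvx, ← exp_neg, ← exp_add, ← exp_zero, exp_le_exp, exp_le_exp]
    omega

/-! ## §3  The shell-label lemma over a valued field with an involutive isometry -/

/-- **THE SHELL-LABEL LEMMA.**  `σ` an involutive isometry, `|ϖ| = exp(−1)`, `|t₊| = exp(−(d % 2))` for the coefficient `t₊ = (ϖ − σϖ)·((ϖσϖ)^{⌊d∕2⌋})⁻¹` of ★ `xPlus`;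
if `X = c • v ⊗ (σv)Φ₃` (`v ≠ 0`) lies on the near-transvection shell `NearTransvShell ϖ (d % 2) m X` and has `NormClassPlus σ ϖ d X`, then `LabelPlus σ ϖ d m X`:
the integral value sets of `X` and `xPlus σ ϖ d` coincide (even exactly). -/
theorem labelPlus_of_shape {σ : K →+* K} (hσ : ∀ x, σ (σ x) = x) (hvσ : ∀ a, Valued.v (σ a) = Valued.v a)
    {ϖ : K} (hϖ : Valued.v ϖ = exp (-1 : ℤ)) {d : ℕ}
    (htp : Valued.v ((ϖ - σ ϖ) * ((ϖ * σ ϖ) ^ ((d - d % 2) / 2))⁻¹) = exp (-((d % 2 : ℕ) : ℤ))) (m : ℕ)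
    {c : K} {v : Fin 3 → K} (hv : v ≠ 0) {X : Matrix (Fin 3) (Fin 3) K}
    (hX : X = c • Matrix.vecMulVec v (Matrix.vecMul (σ ∘ v) ((StdForm.antidiagonal 3).over K)))
    (hsh : NearTransvShell ϖ (d % 2) m X) (hN : NormClassPlus σ ϖ d X) : LabelPlus σ ϖ d m X := by
  -- names: `tp = t₊`, `r = (σv)Φ₃`
  obtain ⟨tp, htpdef⟩ : ∃ tp : K, (ϖ - σ ϖ) * ((ϖ * σ ϖ) ^ ((d - d % 2) / 2))⁻¹ = tp := ⟨_, rfl⟩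
  rw [htpdef] at htp
  obtain ⟨r, hrdef⟩ : ∃ r : Fin 3 → K, Matrix.vecMul (σ ∘ v) ((StdForm.antidiagonal 3).over K) = r := ⟨_, rfl⟩
  have hr : ∀ j, r j = σ (v (Fin.rev j)) := fun j => by rw [← hrdef, vecMul_antidiagonal_three]; rfl
  -- pairing values
  have hpX : ∀ y, pairing σ ((StdForm.antidiagonal 3).over K) y (X.mulVec y) = c * ((r ⬝ᵥ y) * σ (r ⬝ᵥ y)) := fun y => by
    rw [hX, pairing_shape_mulVec hσ, hrdef]
  have hpP : ∀ y, pairing σ ((StdForm.antidiagonal 3).over K) y ((xPlus σ ϖ d).mulVec y) = tp * (y 2 * σ (y 2)) := fun y => by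
    rw [pairing_xPlus_mulVec, htpdef]
  -- the dominant coefficient `r j₀ ≠ 0`
  obtain ⟨j₀, -, hj₀⟩ := Finset.exists_max_image Finset.univ (fun j => Valued.v (r j)) Finset.univ_nonempty
  have hj₀' : ∀ j, Valued.v (r j) ≤ Valued.v (r j₀) := fun j => hj₀ j (Finset.mem_univ j)
  have hvi : ∀ i, Valued.v (v i) ≤ Valued.v (r j₀) := fun i => by
    have h := hj₀' (Fin.rev i)
    rwa [hr, Fin.rev_rev, hvσ] at h
  have hr0 : r j₀ ≠ 0 := by
    obtain ⟨i, hi⟩ := Function.ne_iff.1 hv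
    intro h0
    have h := hvi i
    rw [h0, map_zero, le_zero_iff, map_eq_zero] at h
    exact hi h
  have hσr0 : σ (r j₀) ≠ 0 := (map_ne_zero σ).2 hr0
  have hvr0 : Valued.v (r j₀) ≠ 0 := (Valuation.ne_zero_iff _).2 hr0
  -- entries of `X` and the element `e = c·N(r j₀)` carrying the largest entry valuation
  have hXe : ∀ a b, X a b = c * v a * r b := fun a b => by
    rw [hX, Matrix.smul_apply, Matrix.vecMulVec_apply, smul_eq_mul, mul_assoc, hrdef]
  obtain ⟨e, hedef⟩ : ∃ e : K, c * (r j₀ * σ (r j₀)) = e := ⟨_, rfl⟩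
  have hve' : Valued.v e = Valued.v c * (Valued.v (r j₀) * Valued.v (r j₀)) := by
    rw [← hedef, map_mul, map_mul, hvσ]
  have hentry_le : ∀ a b, Valued.v (X a b) ≤ Valued.v e := fun a b => by
    rw [hXe, map_mul, map_mul, hve', mul_assoc]
    exact mul_le_mul' le_rfl (mul_le_mul' (hvi a) (hj₀' b))
  have hentry_eq : X (Fin.rev j₀) j₀ = e := by
    rw [hXe, ← hedef, hr j₀, hσ]  -- `v (rev j₀) = σ (r j₀)`
    ring
  -- (C1) the shell pins `|e| = exp(−ℓ₀)`
  have hve : Valued.v e = exp (-((d % 2 : ℕ) : ℤ)) := by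
    have hup : Valued.v e ≤ exp (-((d % 2 : ℕ) : ℤ)) := by
      have h1 := (v_inv_varpi_pow_mul_le_one_iff hϖ (d % 2) _).1 (hsh.1 (Fin.rev j₀) j₀)
      rwa [hentry_eq] at h1
    obtain ⟨a, b, hab⟩ : ∃ a b, ¬ Valued.v ((ϖ ^ (d % 2 + 1))⁻¹ * X a b) ≤ 1 := by
      have h2 := hsh.2.1
      unfold InLevel at h2
      push Not at h2
      obtain ⟨a, b, hab⟩ := h2
      exact ⟨a, b, not_le.2 hab⟩
    rw [v_inv_varpi_pow_mul_le_one_iff hϖ, not_le] at hab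
    have hlow : exp (-((d % 2 + 1 : ℕ) : ℤ)) < Valued.v e := hab.trans_le (hentry_le a b)
    have hve0 : Valued.v e ≠ 0 := ne_of_gt (lt_of_le_of_lt zero_le hlow)
    rw [← exp_log hve0, exp_lt_exp] at hlow
    rw [← exp_log hve0, exp_le_exp] at hup
    rw [← exp_log hve0]
    congr 1
    push_cast at hlow hup ⊢
    omega
  -- (C2) `NormClassPlus` puts `e` in the class `t₊·N(u)`
  obtain ⟨y, y', z, hne, heq⟩ := hN
  rw [hpX] at hne heq
  rw [hpP] at heq
  have hs0 : r ⬝ᵥ y ≠ 0 := by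
    intro h0
    exact hne (by rw [h0, map_zero, mul_zero, mul_zero])
  have hσs0 : σ (r ⬝ᵥ y) ≠ 0 := (map_ne_zero σ).2 hs0
  obtain ⟨u, hudef⟩ : ∃ u : K, y' 2 * z * (r ⬝ᵥ y)⁻¹ * r j₀ = u := ⟨_, rfl⟩
  have hc : c = tp * (y' 2 * σ (y' 2)) * (z * σ z) * ((r ⬝ᵥ y) * σ (r ⬝ᵥ y))⁻¹ := by
    rw [← heq, mul_inv_cancel_right₀ (mul_ne_zero hs0 hσs0)]
  have heu : e = tp * (u * σ u) := by
    rw [← hedef, ← hudef, map_mul, map_mul, map_mul, map_inv₀, hc, mul_inv]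
    ring
  -- (C3) `u` is a unit: `|t₊|·|u|² = |e| = |t₊|`
  have hvu : Valued.v u = 1 := by
    have h1 : Valued.v (tp * (u * σ u)) = Valued.v tp := by rw [← heu, hve, htp]
    rw [map_mul, map_mul, hvσ] at h1
    have htp0 : Valued.v tp ≠ 0 := by rw [htp]; exact exp_ne_zero
    have h2 : Valued.v u * Valued.v u = 1 := by
      have h3 := h1.trans (mul_one _).symm
      exact mul_left_cancel₀ htp0 h3
    have hvu0 : Valued.v u ≠ 0 := fun h0 => by rw [h0, mul_zero] at h2; exact zero_ne_one h2
    rw [← exp_log hvu0, ← exp_add, ← exp_zero, exp_inj] at h2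
    rw [← exp_log hvu0, ← exp_zero]
    congr 1
    omega
  have hu0 : u ≠ 0 := fun h0 => by rw [h0, map_zero] at hvu; exact zero_ne_one hvu
  have hσu0 : σ u ≠ 0 := (map_ne_zero σ).2 hu0
  -- (C4) the two integral value sets coincide
  have hsum_le : ∀ y : Fin 3 → K, (∀ a, Valued.v (y a) ≤ 1) → Valued.v (r ⬝ᵥ y) ≤ Valued.v (r j₀) := fun y hy => by
    refine Valuation.map_sum_le _ fun j _ => ?_
    rw [map_mul]
    exact (mul_le_mul' (hj₀' j) (hy j)).trans_eq (mul_one _)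
  refine valueSetMod_eq_of_forall_exists σ ϖ m (X' := xPlus σ ϖ d) ?_ ?_
  · -- a value of `X` on an integral `y` is a value of `X₊` on `u·a·e₂`, `a = s(y)∕r j₀ ∈ 𝒪`
    intro y hy
    obtain ⟨a, hadef⟩ : ∃ a : K, (r j₀)⁻¹ * (r ⬝ᵥ y) = a := ⟨_, rfl⟩
    have ha : Valued.v a ≤ 1 := by
      rw [← hadef, map_mul, map_inv₀]
      exact inv_mul_le_one_of_le₀ (hsum_le y hy) zero_le
    have hsa : r ⬝ᵥ y = r j₀ * a := by rw [← hadef, mul_inv_cancel_left₀ hr0]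
    refine ⟨Pi.single 2 (u * a), fun i => ?_, ?_⟩
    · by_cases hi : i = 2
      · subst hi; rw [Pi.single_eq_same, map_mul, hvu, one_mul]; exact ha
      · rw [Pi.single_eq_of_ne hi, map_zero]; exact zero_le
    · rw [hpP, hpX, Pi.single_eq_same, hsa, map_mul, map_mul, show c * (r j₀ * a * (σ (r j₀) * σ a)) = e * (a * σ a) by rw [← hedef]; ring, heu]
      ring
  · -- a value of `X₊` on an integral `y′` is the value of `X` on `(u⁻¹·y′₂)·e_{j₀}`
    intro y' hy'
    refine ⟨Pi.single j₀ (u⁻¹ * y' 2), fun i => ?_, ?_⟩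
    · by_cases hi : i = j₀
      · subst hi; rw [Pi.single_eq_same, map_mul, map_inv₀, hvu, inv_one, one_mul]; exact hy' _
      · rw [Pi.single_eq_of_ne hi, map_zero]; exact zero_le
    · rw [hpP, hpX, dotProduct_single, map_mul, map_mul, map_inv₀,
        show c * (r j₀ * (u⁻¹ * y' 2) * (σ (r j₀) * ((σ u)⁻¹ * σ (y' 2)))) = e * ((u⁻¹ * y' 2) * ((σ u)⁻¹ * σ (y' 2))) by rw [← hedef]; ring, heu]
      field_simp

end Field

/-! ## §4  At a ramified `σ`-stable CM place: `hShell` discharged -/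

variable (L : Type) [Field L] [NumberField L] [IsCMField L] {v : HeightOneSpectrum (𝓞 ↥(maximalRealSubfield L))}
  (w : UnitaryGroup.PlacesOver L v) (hw : IsCMField.complexConj L • w.1 = w.1)

/-- **THE SHELL-LABEL LEMMA AT THE PLACE.**  At a ramified `σ`-stable place `w ∣ v` of the CM field `L` (`e(w|v) ≠ 1`), with `ϖ` a uniformiser of `L_w` and
`X := wMatrix g − 1` for a local unitary `g`: `NearTransvShell ϖ (dOfPlace % 2) mstarFn X ∧ X² = 0 ∧ NormClassPlus σ_w ϖ dOfPlace X ⇒ LabelPlus σ_w ϖ dOfPlace mstarFn X`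
(§3 at `σ_w` — involutive, isometric — with the shape ★ `exists_eq_smul_vecMulVec_pairing` of the `Φ₃`-unitary `wMatrix g` (★ `coe_mem_unitaryGroupOfForm_over`) and
`dOfPlace L v w = d` for the place's datum (★ `exists_isRamifiedQuadraticDatum_of_placesOver`, ★ `dOfPlace_eq_of_isRamifiedQuadraticDatum`), `|t₊| = exp(−(d % 2))`
(★ `v_refSkewScalar`)). -/
theorem labelPlus_of_normClassPlus_of_nearTransvShell (he : v.asIdeal.ramificationIdx' w.1.asIdeal ≠ 1)
    (ϖ : w.1.adicCompletion L) (hϖ : Valued.v ϖ = WithZero.exp (-1 : ℤ))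
    (g : ((UnitaryGroup.cmDatum L 3 (Matrix.of fun i j : Fin 3 => if i.val + j.val + 1 = 3 then (1 : L) else 0)).Local v))
    (hsh : NearTransvShell ϖ (dOfPlace L v w % 2) (mstarFn L v w) (wMatrix L w hw g - 1))
    (hsq : (wMatrix L w hw g - 1) * (wMatrix L w hw g - 1) = 0)
    (hN : NormClassPlus (galAdicCompletionMap (L := L) (IsCMField.complexConj L) hw) ϖ (dOfPlace L v w) (wMatrix L w hw g - 1)) :
    LabelPlus (galAdicCompletionMap (L := L) (IsCMField.complexConj L) hw) ϖ (dOfPlace L v w) (mstarFn L v w) (wMatrix L w hw g - 1) := by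
  obtain ⟨d, t, hD⟩ := exists_isRamifiedQuadraticDatum_of_placesOver L w hw he ϖ hϖ
  have hdd : dOfPlace L v w = d := dOfPlace_eq_of_isRamifiedQuadraticDatum L w hw he hD
  obtain ⟨hσσ, hvσ, -, -, hdv, -, -⟩ := hD
  have hX0 : wMatrix L w hw g - 1 ≠ 0 := fun h0 => hsh.2.1 (by rw [h0]; exact inLevel_zero ϖ _)
  have hM : ((wMatrix L w hw g).map (galAdicCompletionMap (L := L) (IsCMField.complexConj L) hw))ᵀ * (StdForm.antidiagonal 3).over (w.1.adicCompletion L) *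
      wMatrix L w hw g = (StdForm.antidiagonal 3).over (w.1.adicCompletion L) :=
    mem_unitaryGroupOfForm_iff.1 (F0P3cDyRamProfilePiecesProps.coe_mem_unitaryGroupOfForm_over L w hw g)
  have hΦ : ((StdForm.antidiagonal 3).over (w.1.adicCompletion L)).det ≠ 0 :=
    ((Matrix.isUnit_iff_isUnit_det _).1 ((StdForm.antidiagonal 3).isUnit_over (w.1.adicCompletion L))).ne_zero
  obtain ⟨c, b₀, -, hb₀, hX⟩ := exists_eq_smul_vecMulVec_pairing (galAdicCompletionMap (L := L) (IsCMField.complexConj L) hw)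
    ((StdForm.antidiagonal 3).over (w.1.adicCompletion L)) (wMatrix L w hw g) hΦ hM hsq hX0
  rw [hdd] at hsh hN ⊢
  exact labelPlus_of_shape hσσ hvσ hϖ (v_refSkewScalar hvσ hϖ hdv) (mstarFn L v w) hb₀ hX hsh hN

/-- **`hShell` DISCHARGED** — literally the hypothesis of ★ `table_vanishing_of_shellLabel`: for every `g` in the integral level `K` (a hypothesis carried, not used)
whose `X := wMatrix g − 1` is on the shell with `X² = 0` and `NormClassPlus`, `LabelPlus σ_w ϖ dOfPlace mstarFn X`. -/
theorem shellLabel (he : v.asIdeal.ramificationIdx' w.1.asIdeal ≠ 1) (ϖ : w.1.adicCompletion L) (hϖ : Valued.v ϖ = WithZero.exp (-1 : ℤ)) :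
    ∀ g : ((UnitaryGroup.cmDatum L 3 (Matrix.of fun i j : Fin 3 => if i.val + j.val + 1 = 3 then (1 : L) else 0)).Local v),
      g ∈ cmLocalIntegralLevel L 3 (Matrix.of fun i j : Fin 3 => if i.val + j.val + 1 = 3 then (1 : L) else 0) v →
      NearTransvShell ϖ (dOfPlace L v w % 2) (mstarFn L v w) (wMatrix L w hw g - 1) →
      (wMatrix L w hw g - 1) * (wMatrix L w hw g - 1) = 0 →
      NormClassPlus (galAdicCompletionMap (L := L) (IsCMField.complexConj L) hw) ϖ (dOfPlace L v w) (wMatrix L w hw g - 1) →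
      LabelPlus (galAdicCompletionMap (L := L) (IsCMField.complexConj L) hw) ϖ (dOfPlace L v w) (mstarFn L v w) (wMatrix L w hw g - 1) :=
  fun g _ hsh hsq hN => labelPlus_of_normClassPlus_of_nearTransvShell L w hw he ϖ hϖ g hsh hsq hN

end Summit.HodgeConjecture.HodgeConjecture.Cruxes.H413.F0P3cDyRamShellLabelPlus

end
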